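import Summits.BirchSwinnertonDyer.BirchSwinnertonDyer.Theorems.TameQuarticSolventSolventPairLowerBoundTprimeLocalForm
import Summits.BirchSwinnertonDyer.Rank1Residual.Additive.SemistabilityDefectRamification
import Literature.NumberTheory.DiophantineGeometry.ConductorRingOfIntegersProofs
import Literature.NumberTheory.DiophantineGeometry.MinimalModelUniquenessProofs
import Literature.NumberTheory.DiophantineGeometry.TateAlgorithmProofs
import Literature.NumberTheory.EllipticCurves.RootNumberTableThreeLocalBridgeProofs
import Literature.NumberTheory.EllipticCurves.DegreeConjectureAbcPrelims
import Mathlib.NumberTheory.Padics.RingHoms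
import HarnessLib

/-!
# Route `TameQuarticSolvent`, crux `SolventPairLowerBound` (stmt-BirchSwinnertonDyer-21391), line `birth`,
# stub `stub_goodReduction` — `3`-ADIC HALF: a (t′)-at-`3` curve over `ℚ` has a `ℚ`-model
# `y² + a₁xy + a₃y = x³ + a₂x² + a₄x + a₆` with `ord₃ Δ = 3k` (`k = 1` for III, `k = 3` for III*) and
# `4·ord₃(aᵢ) ≥ i·k` — the input of the quartic descent

HONEST FRAMING. Theorems only; helper toward the registered stub `stub_goodReduction` of the birth skeleton of
the deciding crux of route `TameQuarticSolvent` (`--supports stmt-BirchSwinnertonDyer-21391`). BSD is not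
proved by any of this.

WHAT.
* §1 `exists_natCast_variableChange_congr` — a change of variables over `ℤ_p` is congruent modulo `p^N` to one
  with NATURAL-number entries (`PadicInt.appr`, `p ∤ u'`); the coefficients of `T' • V` and `T • V` then agree
  modulo `p^N` (`PadicInt.toZModPow`, Mathlib `WeierstrassCurve.map_variableChange`). [folklore]
* §2 `conductorExponent_placeOf_eq_padic` — `f_p` (`condExp`) is computed on the `ℤ_p`-minimal model.
* §3 `exists_rat_model_of_subTprime` — for `W/ℚ` globally minimal, elliptic, `Addv W 3`, `SubTprime W 3`:
  there are `C : VariableChange ℚ` and `k ∈ {1, 3}` with `ord₃ Δ(C • W) = 3k` and, for each `i`,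
  `aᵢ(C • W) = 0` or `i·k ≤ 4·ord₃ aᵢ(C • W)` (on the `3`-adic minimal model `M = D • V`: `Addv` ⇒ `3 ∣ Δ, c₄`;
  `¬ PotMult` ⇒ `ord j ≥ 0`; `f₃ = 2`; index `∤ 2` ⇒ `6 ∤ ord Δ`; the companion local file gives the medium form
  `T • V`; §1 replaces `T` by a rational change modulo `3⁶`).

References: J. H. Silverman, *AEC* VII.1 Prop. 1.3; *ATAEC* IV.9.4; I. Papadopoulos, J. Number Theory 44
(1993) Table III; F. Q. Gouvêa, *p-adic Numbers* §3.3 (`ℤ` dense in `ℤ_p`).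
-/

-- D-0017: single-problem summit, so `Summit.BirchSwinnertonDyer.BirchSwinnertonDyer.…` repeats a namespace BY DESIGN.
set_option linter.dupNamespace false

noncomputable section

open IsLocalRing IsDedekindDomain
open IsDiscreteValuationRing hiding maximalIdeal
open Literature Literature.NumberTheory.DiophantineGeometry
  Literature.NumberTheory.DiophantineGeometry.TateAlgorithm
  Literature.NumberTheory.EllipticCurves Literature.NumberTheory.EllipticCurves.Rizzo
  Literature.NumberTheory.EllipticCurves.Rank1Residual
  Summit.BirchSwinnertonDyer.Rank1Residual.Additive

namespace Summit.BirchSwinnertonDyer.BirchSwinnertonDyer.Theorems.SolventPairLowerBound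

/-! ## §1 Approximating a `ℤ_p`-change of variables by a rational one -/

section Approx

variable {p : ℕ} [hp : Fact p.Prime]

/-- **`ℤ` is dense in `ℤ_p`, for changes of variables.** Every `T = (u, r, s, t)` over `ℤ_p` is congruent
modulo `p^N` (`N ≥ 1`) to a change `T' = (u', r', s', t')` with natural-number entries (`PadicInt.appr`),
`p ∤ u'`; for every `ℤ_p`-model `V` the five coefficients of `T' • V` and `T • V` agree modulo `p^N`
(reduce modulo `p^N` with `PadicInt.toZModPow` and use `WeierstrassCurve.map_variableChange`).
[cite: Gouvea1993PadicNumbers, §3.3 (ℤ_p/pⁿℤ_p ≅ ℤ/pⁿ, ℤ dense in ℤ_p)] -/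
theorem exists_natCast_variableChange_congr (T : WeierstrassCurve.VariableChange ℤ_[p]) {N : ℕ}
    (hN : N ≠ 0) :
    ∃ (T' : WeierstrassCurve.VariableChange ℤ_[p]) (u r s t : ℕ), (T'.u : ℤ_[p]) = u ∧ T'.r = r ∧
      T'.s = s ∧ T'.t = t ∧ ¬ p ∣ u ∧ ∀ V : WeierstrassCurve ℤ_[p],
        (T' • V).a₁ - (T • V).a₁ ∈ Ideal.span {(p : ℤ_[p]) ^ N} ∧
        (T' • V).a₂ - (T • V).a₂ ∈ Ideal.span {(p : ℤ_[p]) ^ N} ∧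
        (T' • V).a₃ - (T • V).a₃ ∈ Ideal.span {(p : ℤ_[p]) ^ N} ∧
        (T' • V).a₄ - (T • V).a₄ ∈ Ideal.span {(p : ℤ_[p]) ^ N} ∧
        (T' • V).a₆ - (T • V).a₆ ∈ Ideal.span {(p : ℤ_[p]) ^ N} := by
  set u : ℕ := PadicInt.appr (T.u : ℤ_[p]) N with hu_def
  set r : ℕ := PadicInt.appr T.r N
  set s : ℕ := PadicInt.appr T.s N
  set t : ℕ := PadicInt.appr T.t N
  have hker : ∀ x : ℤ_[p], ((x : ℤ_[p]) - (PadicInt.appr x N : ℤ_[p])) ∈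
      RingHom.ker (PadicInt.toZModPow (p := p) N) := fun x ↦ by
    rw [PadicInt.ker_toZModPow]; exact PadicInt.appr_spec N x
  have hcongr : ∀ x : ℤ_[p], PadicInt.toZModPow N (PadicInt.appr x N : ℤ_[p]) =
      PadicInt.toZModPow N x := fun x ↦ ((RingHom.sub_mem_ker_iff _).mp (hker x)).symm
  -- `u` is a unit of `ℤ_p` and `p ∤ u`
  have hle : Ideal.span {(p : ℤ_[p]) ^ N} ≤ maximalIdeal ℤ_[p] := by
    rw [PadicInt.maximalIdeal_eq_span_p, Ideal.span_singleton_le_span_singleton]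
    exact dvd_pow_self _ hN
  have hures : residue ℤ_[p] (u : ℤ_[p]) = residue ℤ_[p] (T.u : ℤ_[p]) := by
    rw [← sub_eq_zero, ← map_sub, IsLocalRing.residue_eq_zero_iff, ← neg_sub]
    exact (maximalIdeal ℤ_[p]).neg_mem (hle (PadicInt.appr_spec N _))
  have hu : IsUnit (u : ℤ_[p]) := by
    rw [isUnit_iff_residue_ne_zero, hures, ← isUnit_iff_residue_ne_zero]
    exact T.u.isUnit
  have hpu : ¬ p ∣ u := by
    intro h
    have hmem : (u : ℤ_[p]) ∈ maximalIdeal ℤ_[p] := by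
      rw [PadicInt.maximalIdeal_eq_span_p, Ideal.mem_span_singleton]
      exact_mod_cast Nat.cast_dvd_cast h
    exact (IsLocalRing.notMem_maximalIdeal.mpr hu) hmem
  set T' : WeierstrassCurve.VariableChange ℤ_[p] := ⟨hu.unit, r, s, t⟩ with hT'
  refine ⟨T', u, r, s, t, rfl, rfl, rfl, rfl, hpu, fun V ↦ ?_⟩
  have hmap : T'.map (PadicInt.toZModPow (p := p) N : ℤ_[p] →+* ZMod (p ^ N)) =
      T.map (PadicInt.toZModPow (p := p) N : ℤ_[p] →+* ZMod (p ^ N)) := by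
    ext
    · simp only [WeierstrassCurve.VariableChange.map, Units.coe_map, MonoidHom.coe_coe]
      exact hcongr _
    · exact hcongr _
    · exact hcongr _
    · exact hcongr _
  have hW : (T' • V).map (PadicInt.toZModPow (p := p) N : ℤ_[p] →+* ZMod (p ^ N)) =
      (T • V).map (PadicInt.toZModPow (p := p) N : ℤ_[p] →+* ZMod (p ^ N)) := by
    rw [← WeierstrassCurve.map_variableChange, ← WeierstrassCurve.map_variableChange, hmap]
  have key : ∀ {x y : ℤ_[p]}, PadicInt.toZModPow N x = PadicInt.toZModPow N y →
      x - y ∈ Ideal.span {(p : ℤ_[p]) ^ N} := fun h ↦ by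
    rw [← PadicInt.ker_toZModPow]; exact (RingHom.sub_mem_ker_iff _).mpr h
  refine ⟨key ?_, key ?_, key ?_, key ?_, key ?_⟩
  · simpa only [WeierstrassCurve.map_a₁] using congrArg WeierstrassCurve.a₁ hW
  · simpa only [WeierstrassCurve.map_a₂] using congrArg WeierstrassCurve.a₂ hW
  · simpa only [WeierstrassCurve.map_a₃] using congrArg WeierstrassCurve.a₃ hW
  · simpa only [WeierstrassCurve.map_a₄] using congrArg WeierstrassCurve.a₄ hW
  · simpa only [WeierstrassCurve.map_a₆] using congrArg WeierstrassCurve.a₆ hW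

/-- A rational number whose image in `ℚ_p` is a `p`-adic integer divisible by `p^n` is `0` or has
`ord_p ≥ n`. [folklore] -/
theorem eq_zero_or_le_padicValRat_of_coe_eq {x : ℚ} {X : ℤ_[p]} (h : ((X : ℤ_[p]) : ℚ_[p]) = (x : ℚ_[p]))
    {n : ℕ} (hX : X ∈ Ideal.span {(p : ℤ_[p]) ^ n}) : x = 0 ∨ (n : ℤ) ≤ padicValRat p x := by
  by_cases hx : x = 0
  · exact Or.inl hx
  refine Or.inr ?_
  have hX0 : X ≠ 0 := by
    rintro rfl
    rw [PadicInt.coe_zero, eq_comm, Rat.cast_eq_zero] at h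
    exact hx h
  have hv : padicValRat p x = (X.valuation : ℤ) := by
    rw [← Padic.valuation_ratCast, ← h, PadicInt.valuation_coe]
  rw [hv, Nat.cast_le]
  exact (PadicInt.mem_span_pow_iff_le_valuation X hX0 n).mp hX

end Approx

/-! ## §2 The conductor exponent at `placeOf p` computed over `ℤ_p` -/

section PlaceOf

/-- `f_p = W.conductorExponent (placeOf p)` (the currency of `condExp` / `CondExpTwo`) computed over Mathlib's
`ℤ_p`: Ogg's value `ord_p Δ_min + 1 − m` on the integral minimal model of `W ⊗ ℚ_p` (tree
`WeierstrassCurve.conductorExponent_eq_padic`, the place `placeOf p` of `ℤ` lying over `p`). [folklore] -/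
theorem conductorExponent_placeOf_eq_padic (p : ℕ) [Fact p.Prime] (W : WeierstrassCurve ℚ) [W.IsElliptic] :
    W.conductorExponent (placeOf p) =
      (addVal ℤ_[p] (((W.baseChange ℚ_[p]).minimal ℤ_[p]).integralModel ℤ_[p]).Δ).toNat + 1 -
        (((W.baseChange ℚ_[p]).minimal ℤ_[p]).integralModel ℤ_[p]).kodairaSymbolOfMinimal.numComponents := by
  have h := WeierstrassCurve.conductorExponent_eq_padic (placeOf p) W
  have hp : ((Rat.HeightOneSpectrum.primesEquiv (placeOf p) : Nat.Primes) : ℕ) = p :=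
    congrArg Subtype.val ((Rat.HeightOneSpectrum.primesEquiv (R := ℤ)).apply_symm_apply ⟨p, Fact.out⟩)
  generalize Rat.HeightOneSpectrum.primesEquiv (placeOf p) = q at hp h
  obtain ⟨q, hq⟩ := q
  simp only at hp
  subst hp
  exact h

end PlaceOf

/-! ## §3 The rational model of a (t′) curve adapted to the quartic descent -/

section RatModel

variable (W : WeierstrassCurve ℚ) [W.IsElliptic] [W.IsGloballyMinimal]

/-- **The `3`-adic input of the quartic descent.** For a globally minimal elliptic `W/ℚ` additive at `3` of the
census class (t′) (`¬ PotMult`, `f₃ = 2`, semistability index `∤ 2`) there are a change of variables `C`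
over `ℚ` and `k ∈ {1, 3}` (`1` for Kodaira `III`, `3` for `III*`) with `ord₃ Δ(C • W) = 3k` and every
coefficient `aᵢ` of `C • W` zero or with `4·ord₃ aᵢ ≥ i·k`. Proof: on the `3`-adic integral minimal model
`M = D • V` (`V` the integral model of `W ⊗ ℚ₃`, `D` over `ℤ₃` by Silverman *AEC* VII.1.3(b), `W` being
minimal at `3`) the hypotheses read `3 ∣ Δ, c₄`, `ord Δ + 1 − m = 2`, `6 ∤ ord Δ`, `ord j ≥ 0`; the companion
local file (`exists_mediumForm_of_tprime`) gives the medium form `T • V`, and a congruent change with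
natural-number entries modulo `3⁶` (`exists_natCast_variableChange_congr`) gives `C`.
[cite: SilvermanAEC2009, VII.1 Prop. 1.3(b)] [cite: Papadopoulos1993, Table III (p = 3)] -/
theorem exists_rat_model_of_subTprime (hadd : Addv W 3) (hsub : SubTprime W 3) :
    ∃ (C : WeierstrassCurve.VariableChange ℚ) (k : ℕ), (k = 1 ∨ k = 3) ∧
      padicValRat 3 (C • W).Δ = 3 * k ∧
      ((C • W).a₁ = 0 ∨ (k : ℤ) ≤ 4 * padicValRat 3 (C • W).a₁) ∧
      ((C • W).a₂ = 0 ∨ 2 * (k : ℤ) ≤ 4 * padicValRat 3 (C • W).a₂) ∧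
      ((C • W).a₃ = 0 ∨ 3 * (k : ℤ) ≤ 4 * padicValRat 3 (C • W).a₃) ∧
      ((C • W).a₄ = 0 ∨ 4 * (k : ℤ) ≤ 4 * padicValRat 3 (C • W).a₄) ∧
      ((C • W).a₆ = 0 ∨ 6 * (k : ℤ) ≤ 4 * padicValRat 3 (C • W).a₆) := by
  classical
  -- the `3`-adic objects: `W' = W ⊗ ℚ₃`, its integral model `V`, the integral minimal model `M = D • V`
  set W' := W.baseChange ℚ_[3] with hW'
  have hmin : W'.minimal ℤ_[3] = (W'.exists_isMinimal ℤ_[3]).choose • W' := rfl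
  haveI hW'min : W'.IsMinimal ℤ_[3] := by
    set v : HeightOneSpectrum (NumberField.RingOfIntegers ℚ) :=
      (Rat.HeightOneSpectrum.primesEquiv (R := NumberField.RingOfIntegers ℚ)).symm ⟨3, Fact.out⟩ with hv
    have hv3 : ((Rat.HeightOneSpectrum.primesEquiv v : Nat.Primes) : ℕ) = 3 :=
      congrArg Subtype.val
        ((Rat.HeightOneSpectrum.primesEquiv (R := NumberField.RingOfIntegers ℚ)).apply_symm_apply ⟨3, _⟩)
    exact (isMinimalAt_iff_isMinimal_padic v 3 hv3 W).mp (WeierstrassCurve.IsGloballyMinimal.isMinimal v)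
  set V := W'.integralModel ℤ_[3] with hVdef
  have hVmap : V.map (algebraMap ℤ_[3] ℚ_[3]) = W' := WeierstrassCurve.baseChange_integralModel_eq ℤ_[3] W'
  have hWΔ : W.Δ ≠ 0 := W.isUnit_Δ.ne_zero
  have hW'Δ : W'.Δ = (W.Δ : ℚ_[3]) := by rw [hW', WeierstrassCurve.baseChange, WeierstrassCurve.map_Δ]; simp
  have hW'c₄ : W'.c₄ = (W.c₄ : ℚ_[3]) := by rw [hW', WeierstrassCurve.baseChange, WeierstrassCurve.map_c₄]; simp
  have hW'Δ0 : W'.Δ ≠ 0 := by rw [hW'Δ]; exact_mod_cast hWΔ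
  have hVΔ : ((V.Δ : ℤ_[3]) : ℚ_[3]) = (W.Δ : ℚ_[3]) :=
    (WeierstrassCurve.integralModel_Δ_eq ℤ_[3] W').trans hW'Δ
  have hVc₄ : ((V.c₄ : ℤ_[3]) : ℚ_[3]) = (W.c₄ : ℚ_[3]) :=
    (WeierstrassCurve.integralModel_c₄_eq ℤ_[3] W').trans hW'c₄
  have hV0 : V.Δ ≠ 0 := by
    intro h
    rw [h, PadicInt.coe_zero, eq_comm, Rat.cast_eq_zero] at hVΔ
    exact hWΔ hVΔ
  obtain ⟨D, -, hMD⟩ := WeierstrassCurve.exists_variableChange_integralModel_eq ℤ_[3] hmin hW'Δ0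
  set M := D • V with hMdef
  haveI : Finite (ResidueField ℤ_[3]) :=
    Finite.of_equiv _ (PadicInt.residueField (p := 3)).toEquiv.symm
  have h2 : IsUnit (2 : ℤ_[3]) := isUnit_two_padicInt_three
  have h3 : Irreducible (3 : ℤ_[3]) := by simpa using PadicInt.irreducible_p (p := 3)
  have e3 : ((3 : ℕ) : ℤ_[3]) = 3 := by norm_num
  have hmax : maximalIdeal ℤ_[3] = Ideal.span {(3 : ℤ_[3])} := by
    rw [PadicInt.maximalIdeal_eq_span_p, e3]
  have hmaxpow : ∀ n : ℕ, maximalIdeal ℤ_[3] ^ n = Ideal.span {((3 : ℕ) : ℤ_[3]) ^ n} := fun n ↦ by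
    rw [PadicInt.maximalIdeal_eq_span_p, Ideal.span_singleton_pow]
  have haddu : addVal ℤ_[3] ((D.u⁻¹ : ℤ_[3]ˣ) : ℤ_[3]) = 0 := by
    exact addVal_def ((D.u⁻¹ : ℤ_[3]ˣ) : ℤ_[3]) D.u⁻¹ h3 0 (by rw [pow_zero, mul_one])
  have hMΔ : M.Δ = ((D.u⁻¹ : ℤ_[3]ˣ) : ℤ_[3]) ^ 12 * V.Δ := by
    rw [hMdef, WeierstrassCurve.variableChange_Δ]
  have hMc₄ : M.c₄ = ((D.u⁻¹ : ℤ_[3]ˣ) : ℤ_[3]) ^ 4 * V.c₄ := by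
    rw [hMdef, WeierstrassCurve.variableChange_c₄]
  have hM0 : M.Δ ≠ 0 := by
    rw [hMΔ]; exact mul_ne_zero (pow_ne_zero _ (Units.ne_zero _)) hV0
  have hvalMΔ : (addVal ℤ_[3] M.Δ).toNat = (addVal ℤ_[3] V.Δ).toNat := by
    rw [hMΔ, addVal_mul, addVal_pow, haddu]; simp
  have hvalMc₄ : (addVal ℤ_[3] M.c₄).toNat = (addVal ℤ_[3] V.c₄).toNat := by
    rw [hMc₄, addVal_mul, addVal_pow, haddu]; simp
  have hWΔval : padicValRat 3 W.Δ = ((addVal ℤ_[3] V.Δ).toNat : ℤ) := by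
    have h := congrArg Padic.valuation hVΔ
    rw [PadicInt.valuation_coe, Padic.valuation_ratCast] at h
    rw [addVal_toNat_eq_valuation]; exact h.symm
  -- (a) additive reduction: `3 ∣ Δ(M)`, `3 ∣ c₄(M)`
  have hΔmem : M.Δ ∈ maximalIdeal ℤ_[3] := by
    have h := hadd.1
    rw [WeierstrassCurve.HasGoodReductionAtPrime,
      WeierstrassCurve.hasGoodReduction_iff_integralModel_Δ_notMem, hMD, not_not] at h
    exact h
  have hΔ3 : (3 : ℤ_[3]) ∣ M.Δ := by
    rw [hmax, Ideal.mem_span_singleton] at hΔmem; exact hΔmem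
  have hc₄mem : M.c₄ ∈ maximalIdeal ℤ_[3] := by
    by_contra hc
    apply hadd.2
    rw [WeierstrassCurve.HasMultiplicativeReductionAtPrime, WeierstrassCurve.hasMultiplicativeReduction_iff]
    refine ⟨inferInstance, ?_, ?_⟩
    · rw [← WeierstrassCurve.integralModel_Δ_eq ℤ_[3] (W'.minimal ℤ_[3]), hMD]
      exact (HeightOneSpectrum.valuation_lt_one_iff_mem _ _).mpr hΔmem
    · rw [← WeierstrassCurve.integralModel_c₄_eq ℤ_[3] (W'.minimal ℤ_[3]), hMD]
      exact (HeightOneSpectrum.valuation_eq_one_iff_notMem _).mpr hc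
  have hc₄3 : (3 : ℤ_[3]) ∣ M.c₄ := by
    rw [hmax, Ideal.mem_span_singleton] at hc₄mem; exact hc₄mem
  -- (b) `f₃ = 2`
  have hf : (addVal ℤ_[3] M.Δ).toNat + 1 - M.kodairaSymbolOfMinimal.numComponents = 2 := by
    have hf0 : W.conductorExponent (placeOf 3) = 2 := hsub.2.1
    rw [conductorExponent_placeOf_eq_padic 3 W] at hf0
    change (addVal ℤ_[3] ((W'.minimal ℤ_[3]).integralModel ℤ_[3]).Δ).toNat + 1 -
      ((W'.minimal ℤ_[3]).integralModel ℤ_[3]).kodairaSymbolOfMinimal.numComponents = 2 at hf0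
    rw [hMD] at hf0
    exact hf0
  -- (c) semistability index `∤ 2`: `6 ∤ ord Δ`
  have h6 : ¬ 6 ∣ (addVal ℤ_[3] M.Δ).toNat := by
    have he : ¬ semistabilityIndex W 3 ∣ 2 := hsub.2.2
    rw [semistabilityIndex_dvd_two_iff] at he
    intro h6
    apply he
    have hcast : (padicValInt 3 W.minimalDiscriminantInt : ℤ) = ((addVal ℤ_[3] M.Δ).toNat : ℤ) := by
      rw [← padicValRat_Δ_eq W 3, hWΔval, hvalMΔ]
    have hnat : padicValInt 3 W.minimalDiscriminantInt = (addVal ℤ_[3] M.Δ).toNat := by exact_mod_cast hcast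
    rw [hnat]; exact h6
  -- (d) potentially good: `c₄ = 0 ∨ ord Δ ≤ 3 ord c₄`
  have hj : M.c₄ = 0 ∨ (addVal ℤ_[3] M.Δ).toNat ≤ 3 * (addVal ℤ_[3] M.c₄).toNat := by
    by_cases hc4 : W.c₄ = 0
    · left
      rw [hc4, Rat.cast_zero] at hVc₄
      have hV : V.c₄ = 0 := PadicInt.coe_eq_zero.mp hVc₄
      rw [hMc₄, hV, mul_zero]
    · right
      have hjv : 0 ≤ padicValRat 3 W.j := not_lt.mp hsub.1
      have hVc0 : V.c₄ ≠ 0 := by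
        intro h
        rw [h, PadicInt.coe_zero, eq_comm, Rat.cast_eq_zero] at hVc₄
        exact hc4 hVc₄
      have hWc₄val : padicValRat 3 W.c₄ = ((addVal ℤ_[3] V.c₄).toNat : ℤ) := by
        have h := congrArg Padic.valuation hVc₄
        rw [PadicInt.valuation_coe, Padic.valuation_ratCast] at h
        rw [addVal_toNat_eq_valuation]; exact h.symm
      have hj' : padicValRat 3 W.j = 3 * padicValRat 3 W.c₄ - padicValRat 3 W.Δ := by
        rw [WeierstrassCurve.j, Units.val_inv_eq_inv_val, WeierstrassCurve.coe_Δ',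
          padicValRat.mul (inv_ne_zero hWΔ) (pow_ne_zero _ hc4), padicValRat.inv, padicValRat.pow]
        ring
      rw [hvalMΔ, hvalMc₄]
      have : ((addVal ℤ_[3] V.Δ).toNat : ℤ) ≤ 3 * ((addVal ℤ_[3] V.c₄).toNat : ℤ) := by
        rw [← hWΔval, ← hWc₄val]; linarith
      exact_mod_cast this
  -- (e) minimality of `M` (Step 11 of Tate's algorithm never fires)
  have hmin11 : ∀ D' : WeierstrassCurve.VariableChange ℤ_[3], D'.u = 1 →
      uniformizer ℤ_[3] ∣ (D' • M).a₁ → uniformizer ℤ_[3] ^ 2 ∣ (D' • M).a₂ →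
      uniformizer ℤ_[3] ^ 3 ∣ (D' • M).a₃ → uniformizer ℤ_[3] ^ 4 ∣ (D' • M).a₄ →
      uniformizer ℤ_[3] ^ 6 ∣ (D' • M).a₆ → False := by
    intro D' _ h1 h2' h3' h4 h6'
    have hM' : (M.baseChange ℚ_[3]).IsMinimal ℤ_[3] := by
      rw [← hMD, WeierstrassCurve.baseChange_integralModel_eq ℤ_[3] (W'.minimal ℤ_[3])]
      infer_instance
    exact not_isMinimal_of_pow_dvd ℚ_[3] hM0 D' h1 h2' h3' h4 h6' hM'
  -- THE LOCAL THEOREM: medium form `T • V = (C * D) • V` of type III / III*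
  obtain ⟨C, hCu, hA₁, hA₃, hcases⟩ :=
    exists_mediumForm_of_tprime h2 h3 M hM0 hmin11 hΔ3 hc₄3 hf h6 hj
  have hT : C • M = (C * D) • V := by rw [hMdef, mul_smul]
  obtain ⟨k, k₂, k₄, k₆, hk, hordΔ, hA₂, hA₄, hA₆, hk₂, hk₄, hk₆, hk₂6, hk₄6, hk₆6⟩ :
      ∃ k k₂ k₄ k₆ : ℕ, (k = 1 ∨ k = 3) ∧ (addVal ℤ_[3] M.Δ).toNat = 3 * k ∧
        (C • M).a₂ ∈ Ideal.span {((3 : ℕ) : ℤ_[3]) ^ k₂} ∧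
        (C • M).a₄ ∈ Ideal.span {((3 : ℕ) : ℤ_[3]) ^ k₄} ∧
        (C • M).a₆ ∈ Ideal.span {((3 : ℕ) : ℤ_[3]) ^ k₆} ∧
        2 * k ≤ 4 * k₂ ∧ 4 * k ≤ 4 * k₄ ∧ 6 * k ≤ 4 * k₆ ∧ k₂ ≤ 6 ∧ k₄ ≤ 6 ∧ k₆ ≤ 6 := by
    rcases hcases with ⟨h₂, h₄, h₆, hv⟩ | ⟨h₂, h₄, h₆, hv⟩
    · refine ⟨1, 1, 1, 2, Or.inl rfl, by omega, ?_, ?_, ?_, by norm_num, by norm_num, by norm_num,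
        by norm_num, by norm_num, by norm_num⟩
      · rw [← hmaxpow, pow_one]; exact h₂
      · rw [← hmaxpow, pow_one]; exact h₄
      · rw [← hmaxpow]; exact h₆
    · refine ⟨3, 2, 3, 5, Or.inr rfl, by omega, ?_, ?_, ?_, by norm_num, by norm_num, by norm_num,
        by norm_num, by norm_num, by norm_num⟩
      · rw [← hmaxpow]; exact h₂
      · rw [← hmaxpow]; exact h₄
      · rw [← hmaxpow]; exact h₆
  -- approximate `T = C * D` by a change with natural-number entries modulo `3⁶`
  obtain ⟨T', u, r, s, t, hTu, hTr, hTs, hTt, hpu, hcong⟩ :=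
    exists_natCast_variableChange_congr (p := 3) (C * D) (N := 6) (by norm_num)
  obtain ⟨e₁, e₂, e₃, e₄, e₆⟩ := hcong V
  have hu0 : (u : ℚ) ≠ 0 := by
    have : u ≠ 0 := fun h ↦ hpu (h ▸ dvd_zero 3)
    exact_mod_cast this
  set Cq : WeierstrassCurve.VariableChange ℚ := ⟨Units.mk0 (u : ℚ) hu0, r, s, t⟩ with hCq
  -- the rational model `Cq • W` base-changes to `T' • V`
  have hCqmap : Cq.map (algebraMap ℚ ℚ_[3]) = T'.map (algebraMap ℤ_[3] ℚ_[3]) := by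
    ext <;> simp [hCq, hTu, hTr, hTs, hTt, WeierstrassCurve.VariableChange.map]
  have hmodel : (Cq • W).map (algebraMap ℚ ℚ_[3]) = (T' • V).map (algebraMap ℤ_[3] ℚ_[3]) := by
    rw [← WeierstrassCurve.map_variableChange, ← WeierstrassCurve.map_variableChange, hCqmap, hVmap]
    rfl
  have hcoe : ∀ {x : ℚ} {X : ℤ_[3]}, algebraMap ℚ ℚ_[3] x = algebraMap ℤ_[3] ℚ_[3] X →
      ((X : ℤ_[3]) : ℚ_[3]) = (x : ℚ_[3]) := fun {x X} h ↦ by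
    rw [eq_ratCast] at h; exact h.symm
  have hc₁ : (((T' • V).a₁ : ℤ_[3]) : ℚ_[3]) = ((Cq • W).a₁ : ℚ_[3]) :=
    hcoe (by simpa only [WeierstrassCurve.map_a₁] using congrArg WeierstrassCurve.a₁ hmodel)
  have hc₂ : (((T' • V).a₂ : ℤ_[3]) : ℚ_[3]) = ((Cq • W).a₂ : ℚ_[3]) :=
    hcoe (by simpa only [WeierstrassCurve.map_a₂] using congrArg WeierstrassCurve.a₂ hmodel)
  have hc₃ : (((T' • V).a₃ : ℤ_[3]) : ℚ_[3]) = ((Cq • W).a₃ : ℚ_[3]) :=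
    hcoe (by simpa only [WeierstrassCurve.map_a₃] using congrArg WeierstrassCurve.a₃ hmodel)
  have hc₄' : (((T' • V).a₄ : ℤ_[3]) : ℚ_[3]) = ((Cq • W).a₄ : ℚ_[3]) :=
    hcoe (by simpa only [WeierstrassCurve.map_a₄] using congrArg WeierstrassCurve.a₄ hmodel)
  have hc₆ : (((T' • V).a₆ : ℤ_[3]) : ℚ_[3]) = ((Cq • W).a₆ : ℚ_[3]) :=
    hcoe (by simpa only [WeierstrassCurve.map_a₆] using congrArg WeierstrassCurve.a₆ hmodel)
  -- membership of the coefficients of `T' • V` in the right powers of `(3)`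
  have hle : ∀ {n : ℕ}, n ≤ 6 →
      Ideal.span {((3 : ℕ) : ℤ_[3]) ^ 6} ≤ Ideal.span {((3 : ℕ) : ℤ_[3]) ^ n} := fun hn ↦
    Ideal.span_singleton_le_span_singleton.mpr (pow_dvd_pow _ hn)
  have hmem : ∀ {n : ℕ} {x y : ℤ_[3]}, n ≤ 6 → x - y ∈ Ideal.span {((3 : ℕ) : ℤ_[3]) ^ 6} →
      y ∈ Ideal.span {((3 : ℕ) : ℤ_[3]) ^ n} → x ∈ Ideal.span {((3 : ℕ) : ℤ_[3]) ^ n} :=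
    fun hn hxy hy ↦ by simpa using Ideal.add_mem _ (hle hn hxy) hy
  rw [hT] at hA₁ hA₃ hA₂ hA₄ hA₆
  have hm₁ : (T' • V).a₁ ∈ Ideal.span {((3 : ℕ) : ℤ_[3]) ^ 6} :=
    hmem le_rfl e₁ (by rw [hA₁]; exact Ideal.zero_mem _)
  have hm₃ : (T' • V).a₃ ∈ Ideal.span {((3 : ℕ) : ℤ_[3]) ^ 6} :=
    hmem le_rfl e₃ (by rw [hA₃]; exact Ideal.zero_mem _)
  have hm₂ : (T' • V).a₂ ∈ Ideal.span {((3 : ℕ) : ℤ_[3]) ^ k₂} := hmem hk₂6 e₂ hA₂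
  have hm₄ : (T' • V).a₄ ∈ Ideal.span {((3 : ℕ) : ℤ_[3]) ^ k₄} := hmem hk₄6 e₄ hA₄
  have hm₆ : (T' • V).a₆ ∈ Ideal.span {((3 : ℕ) : ℤ_[3]) ^ k₆} := hmem hk₆6 e₆ hA₆
  -- the discriminant: `ord₃ Δ(Cq • W) = ord₃ Δ(W) = ord Δ(M) = 3k`
  have hk3 : k ≤ 3 := by rcases hk with rfl | rfl <;> norm_num
  have hΔq : padicValRat 3 (Cq • W).Δ = 3 * k := by
    have hu3 : padicValRat 3 (u : ℚ) = 0 := by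
      rw [padicValRat.of_nat]; exact_mod_cast padicValNat.eq_zero_of_not_dvd hpu
    have hCu : (↑Cq.u⁻¹ : ℚ) = (u : ℚ)⁻¹ := by simp [hCq]
    rw [WeierstrassCurve.variableChange_Δ, hCu, padicValRat.mul (pow_ne_zero _ (inv_ne_zero hu0)) hWΔ,
      padicValRat.pow, padicValRat.inv, hu3, hWΔval, ← hvalMΔ, hordΔ]
    push_cast; ring
  refine ⟨Cq, k, hk, hΔq, ?_, ?_, ?_, ?_, ?_⟩
  · rcases eq_zero_or_le_padicValRat_of_coe_eq hc₁ hm₁ with h | h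
    · exact Or.inl h
    · right; omega
  · rcases eq_zero_or_le_padicValRat_of_coe_eq hc₂ hm₂ with h | h
    · exact Or.inl h
    · right; omega
  · rcases eq_zero_or_le_padicValRat_of_coe_eq hc₃ hm₃ with h | h
    · exact Or.inl h
    · right; omega
  · rcases eq_zero_or_le_padicValRat_of_coe_eq hc₄' hm₄ with h | h
    · exact Or.inl h
    · right; omega
  · rcases eq_zero_or_le_padicValRat_of_coe_eq hc₆ hm₆ with h | h
    · exact Or.inl h
    · right; omega

end RatModel

end Summit.BirchSwinnertonDyer.BirchSwinnertonDyer.Theorems.SolventPairLowerBound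

end
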